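import Literature.AnabelianGeometry.AbsoluteAnabelian.AbsTopIProp23iGFGSurfaceModel
import Literature.AnabelianGeometry.AbsoluteAnabelian.AbsTopIDeltaOneFreeProlRankProofs
import HarnessLib

/-!
# [AbsTopI] Thm 2.6: PINNING of the prime set `Σ` by `Δ` at the GFG surface model (`δ¹_l ≥ 1` for `l ∈ Σ`)

S. Mochizuki, *Topics in Absolute Anabelian Geometry I: Generalities* (2012) [AbsTopI] (lit key
`paper:url-11ac98ba15fc`), Thm 2.6 p. 21 (`δ¹_l(H) := dim_{ℚ_l} H¹(H, ℚ_l)`, `ε`, `θ`) and (iii) p. 22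
("`θ²(Π) ⊆ Σ`; if moreover `|θ¹(Π)| ≥ 2`, then `θ²(Π) = Σ`").  The typed second clause needs, among its
hypotheses, that `Σ` is PINNED by `Δ` — every `l ∈ Σ` actually OCCURS in `Δ` (`IsProSet Δ S` is only an upper bound;
abc-iut F-w6d073-1, L4 RULING #8i (3) «(P)»).  PROOF-ONLY file (no definition, no named fact): at the GFG construction
of Def 2.1 (i) (proper case, `AbsTopIProp23iGFGSurfaceModel.lean` p440186) the pinning holds in the strong form

* `freeProlRank_map_eq` — `freeProlRank π(U) l = 2·([P : U](g − 1) + 1)` (`= 2 g_Y ≥ 4`) for every prime `l ∈ Σ`;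
* `deltaInv_one_map_eq`, `two_le_deltaInv_one_map`, `one_le_deltaInv_one_map` — the same for the print-literal
  invariant `δ¹_l(π(U)) = dim H¹(π(U), ℚ_l)` (bridge `deltaInv_one_eq_freeProlRank`), hence `δ¹_l ≥ 2 ≥ 1`;
* `exists_isOpen_one_le_deltaInv_one` — the (P)-shaped conjunct «`∀ l ∈ Σ` prime, `∃ V ≤ D` open with
  `1 ≤ δ¹_l(V)`» for `D = Δ_X`,
and, model-free, `one_le_deltaInv_one_of_isProSigmaCompletion_surfaceGroup`: ANY profinite group presented as a
pro-`Σ` completion of a closed surface group `S_g`, `g ≥ 2`, has `δ¹_l = 2g ≥ 1` at every prime `l ∈ Σ`.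
Classical; OUR kernel check; nothing here bears on [IUTchIII] Cor. 3.12.
-/

noncomputable section

open Topology

universe u

namespace Literature.AnabelianGeometry.AbsoluteAnabelian

namespace GFGSurfaceModel

open Literature.AnabelianGeometry.SemiGraphs.PSCDatum (IsMaxProSigmaQuotient)
open Literature.AnabelianGeometry.SemiGraphs.SemiGraphOfAnabelioids
open Literature.AnabelianGeometry.SemiGraphs.SemiGraphOfAnabelioids.IsProSigmaCompletion
open Literature.GroupTheory.CombinatorialGroupTheory
open Literature.GroupTheory.ProfiniteSubquotients
open Literature.Topology.FourManifolds (SurfaceGroup)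

/-- **Model-free pinning**: a profinite group `Q` presented as a pro-`Σ` completion of a closed surface group
`Γ ≅ S_g` has `δ¹_l(Q) = 2g` at every prime `l ∈ Σ` (`freeProlRank_eq_of_surfaceGroup` through the bridge
`deltaInv_one_eq_freeProlRank`). [cite: MochizukiAbsTopI2012, Thm 2.6 p.21] -/
theorem deltaInv_one_eq_of_isProSigmaCompletion_surfaceGroup {Sigma : Set ℕ} {Γ : Type*} [Group Γ]
    {Q : Type u} [Group Q] [TopologicalSpace Q] [IsTopologicalGroup Q] [CompactSpace Q] [T2Space Q]
    [TotallyDisconnectedSpace Q] {κ : Γ →* Q} (hκ : IsProSigmaCompletion Sigma κ) {g : ℕ}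
    (e : Γ ≃* SurfaceGroup g) {l : ℕ} [Fact l.Prime] (hl : l ∈ Sigma) :
    deltaInv Q 1 l = ((2 * g : ℕ) : ℕ∞) := by
  rw [deltaInv_one_eq_freeProlRank, freeProlRank_eq_of_surfaceGroup hκ e hl]

/-- **Model-free pinning, inequality form**: `1 ≤ δ¹_l(Q)` for `Q` a pro-`Σ` completion of `S_g`, `g ≥ 2`, `l ∈ Σ`
prime. [cite: MochizukiAbsTopI2012, Thm 2.6 p.21] -/
theorem one_le_deltaInv_one_of_isProSigmaCompletion_surfaceGroup {Sigma : Set ℕ} {Γ : Type*} [Group Γ]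
    {Q : Type u} [Group Q] [TopologicalSpace Q] [IsTopologicalGroup Q] [CompactSpace Q] [T2Space Q]
    [TotallyDisconnectedSpace Q] {κ : Γ →* Q} (hκ : IsProSigmaCompletion Sigma κ) {g : ℕ} (hg : 2 ≤ g)
    (e : Γ ≃* SurfaceGroup g) {l : ℕ} [Fact l.Prime] (hl : l ∈ Sigma) :
    (1 : ℕ∞) ≤ deltaInv Q 1 l := by
  rw [deltaInv_one_eq_of_isProSigmaCompletion_surfaceGroup hκ e hl]
  exact_mod_cast (by omega : 1 ≤ 2 * g)

variable {Sigma Sigma' : Set ℕ} {Γ : Type*} [Group Γ]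
  {P : Type u} [Group P] [TopologicalSpace P] [IsTopologicalGroup P] [CompactSpace P]
  [TotallyDisconnectedSpace P]
  {D : Type u} [Group D] [TopologicalSpace D] [IsTopologicalGroup D] [CompactSpace D] [T2Space D]
  {j : Γ →* P} {π : P →* D} {U : Subgroup P}

/-- **`δ¹_l(π(U)) = freeProlRank π(U) l = 2 g_Y`, `g_Y = [P : U](g − 1) + 1`**, at the GFG construction, for every
prime `l ∈ Σ` (F_cov for `j⁻¹U ≅ S_{g_Y}`, `[Γ : j⁻¹U] = [P : U]`, and `π(U)` a pro-`Σ` completion of `j⁻¹U`).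
[cite: MochizukiAbsTopI2012, Thm 2.6 p.21] -/
theorem freeProlRank_map_eq (hSS : Sigma ⊆ Sigma') {g : ℕ} (hg : 2 ≤ g) (e : Γ ≃* SurfaceGroup g)
    (hj : IsProSigmaCompletion Sigma' j) (hUo : IsOpen (U : Set P)) (hπc : Continuous π)
    (hmax : IsMaxProSigmaQuotient Sigma (π.subgroupMap U)) {l : ℕ} [Fact l.Prime] (hl : l ∈ Sigma) :
    freeProlRank (U.map π) l = ((2 * (U.index * (g - 1) + 1) : ℕ) : ℕ∞) := by
  haveI : CompactSpace (U.map π) := compactSpace_of_isClosed (isClosed_map hUo hπc)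
  haveI : (U.comap j).FiniteIndex := finiteIndex_comap hj U hUo
  have hidx : (U.comap j).index = U.index := index_comap_of_isOpen hj U hUo
  obtain ⟨g', hg'eq, ⟨eU⟩⟩ := exists_mulEquiv_surfaceGroup_of_finiteIndex hg e (U.comap j)
  rw [freeProlRank_eq_of_surfaceGroup (isProSigmaCompletion_map hSS hj hUo hπc hmax) eU hl, hg'eq, hidx]

/-- **`δ¹_l(π(U)) = 2 g_Y`** in the print-literal vocabulary `deltaInv` (continuous `H¹` with `ℚ_l`-coefficients).
[cite: MochizukiAbsTopI2012, Thm 2.6 p.21] -/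
theorem deltaInv_one_map_eq (hSS : Sigma ⊆ Sigma') {g : ℕ} (hg : 2 ≤ g) (e : Γ ≃* SurfaceGroup g)
    (hj : IsProSigmaCompletion Sigma' j) (hUo : IsOpen (U : Set P)) (hπc : Continuous π)
    (hmax : IsMaxProSigmaQuotient Sigma (π.subgroupMap U)) {l : ℕ} [Fact l.Prime] (hl : l ∈ Sigma) :
    deltaInv (U.map π) 1 l = ((2 * (U.index * (g - 1) + 1) : ℕ) : ℕ∞) := by
  haveI : CompactSpace (U.map π) := compactSpace_of_isClosed (isClosed_map hUo hπc)
  rw [deltaInv_one_eq_freeProlRank, freeProlRank_map_eq hSS hg e hj hUo hπc hmax hl]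

/-- **`2 ≤ δ¹_l(π(U))`** for every prime `l ∈ Σ` at the GFG construction (`g_Y ≥ 2`, so `2 g_Y ≥ 4 ≥ 2`).
[cite: MochizukiAbsTopI2012, Thm 2.6 p.21] -/
theorem two_le_deltaInv_one_map (hSS : Sigma ⊆ Sigma') {g : ℕ} (hg : 2 ≤ g) (e : Γ ≃* SurfaceGroup g)
    (hj : IsProSigmaCompletion Sigma' j) (hUo : IsOpen (U : Set P)) (hπc : Continuous π)
    (hmax : IsMaxProSigmaQuotient Sigma (π.subgroupMap U)) {l : ℕ} [Fact l.Prime] (hl : l ∈ Sigma) :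
    (2 : ℕ∞) ≤ deltaInv (U.map π) 1 l := by
  rw [deltaInv_one_map_eq hSS hg e hj hUo hπc hmax hl]
  exact_mod_cast (by omega : 2 ≤ 2 * (U.index * (g - 1) + 1))

/-- **`1 ≤ δ¹_l(π(U))`** for every prime `l ∈ Σ` — the open subgroup `π(U) = Ker(Δ_X → Gal(Y/X))` of `Δ_X` pins
`Σ`. [cite: MochizukiAbsTopI2012, Thm 2.6 p.21] -/
theorem one_le_deltaInv_one_map (hSS : Sigma ⊆ Sigma') {g : ℕ} (hg : 2 ≤ g) (e : Γ ≃* SurfaceGroup g)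
    (hj : IsProSigmaCompletion Sigma' j) (hUo : IsOpen (U : Set P)) (hπc : Continuous π)
    (hmax : IsMaxProSigmaQuotient Sigma (π.subgroupMap U)) {l : ℕ} [Fact l.Prime] (hl : l ∈ Sigma) :
    (1 : ℕ∞) ≤ deltaInv (U.map π) 1 l :=
  le_trans (by exact_mod_cast (by omega : (1 : ℕ) ≤ 2)) (two_le_deltaInv_one_map hSS hg e hj hUo hπc hmax hl)

/-- **(P) at the GFG construction**: for every prime `l ∈ Σ` there is an OPEN subgroup `V ≤ D = Δ_X` with
`1 ≤ δ¹_l(V)` — namely `V = π(U)`.  (The pinning conjunct of the successor statement of [AbsTopI] Thm 2.6 (iii),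
abc-iut L4 RULING #8i (3), DISCHARGED at this model.) [cite: MochizukiAbsTopI2012, Thm 2.6 (iii) p.22] -/
theorem exists_isOpen_one_le_deltaInv_one (hSS : Sigma ⊆ Sigma') {g : ℕ} (hg : 2 ≤ g) (e : Γ ≃* SurfaceGroup g)
    (hj : IsProSigmaCompletion Sigma' j) (hUo : IsOpen (U : Set P)) (hπc : Continuous π)
    (hπs : Function.Surjective π) (hker : π.ker ≤ U) (hmax : IsMaxProSigmaQuotient Sigma (π.subgroupMap U)) :
    ∀ l ∈ Sigma, ∀ (hl : l.Prime), ∃ V : Subgroup D, IsOpen (V : Set D) ∧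
      (1 : ℕ∞) ≤ @deltaInv V _ _ _ 1 l ⟨hl⟩ := by
  intro l hlS hl
  haveI : Fact l.Prime := ⟨hl⟩
  exact ⟨U.map π, isOpen_map hUo hπc hπs hker, one_le_deltaInv_one_map hSS hg e hj hUo hπc hmax hlS⟩

end GFGSurfaceModel

end Literature.AnabelianGeometry.AbsoluteAnabelian

end
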